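import Mathlib
import Literature.MathematicalPhysics.QuantumFieldTheory.Balaban1983to89.B12Sec2to5

/-!
# `Balaban1983to89.B12StepObligation` — the small-field step obligation of [Balaban1987RG1] Theorem 3, sourced
field by field from §§2–5 of that paper and from [Balaban1988RG2Cluster]

T. Bałaban, *Renormalization group approach to lattice gauge field theories. I. Generation of effective actions in a
small field approximation and a coupling constant renormalization in four dimensions*, Commun. Math. Phys. **109**,
249–301 (1987) [Balaban1987RG1] (cell paper B12; PDF page = journal page − 248, `paper:balaban1987-cmp109-rg-i-small-field`)
and *II. Cluster expansions*, Commun. Math. Phys. **116**, 1–22 (1988) [Balaban1988RG2Cluster] (cell paper B13 = "[II]";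
journal page = PDF page, `paper:balaban1988-cmp116-rg-ii-cluster`).

CITATION HEADER (lean-in-tree rule 2026-08-18).  This module is a TYPED SKELETON (statement level): it BINDS three
already-landed typings of the inductive step `k → k+1` of B12 Theorem 3 (p. 264) to one another and records, clause by
clause, which printed statement sources each clause.  The three typings are: (r2/b13) the abstract node
`B13.SmallFieldStep D K γ` over the run carrier `B12.RunData` (`IndAss k` = *"A_k satisfies all the inductive assumptions
described between (1.1)–(1.22)"*), closed in print by [II] p. 22 *"The above remark completes the proof of the inductive
assumptions for the action A_{k+1}, hence the proof of Theorem I.3."*; (f2) the clause-level obligation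
`Step.SFNewTerm T c k` over the small-field tower `Step.SFTower` (fields `rg` (2.15), `localDep` (1.7), `bound118` (1.18),
`spaceInv` + `gaugeInv119` (1.19), `betaSmooth` + `betaBound` p. 264) with the kernel-checked equivalence
`Step.B12Thm3Shape_iff_obligation`; (b03, §2) the printed reduction `B12Sec2to5.Sec2Reduction` — B12 p. 268 *"By the
inductive assumption, and by the properties of the expressions given by explicit formulas, all terms in this representation
satisfy the required properties, except possibly the last term (2.13) in the sum."*, p. 269 *"Thus the proof of Theorem 3 is
reduced to proving the remaining properties of (2.13), i.e. to a construction of the representation (1.7) with terms having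
the analytic extensions satisfying the bound (1.18)."*
WHAT IS REPRODUCED, and nothing else:
* Part A — a DICTIONARY `StepDict` between the one-step carrier `B13.StepData` of [II] (indexed here by the value `g` of
  the coupling at which the step is performed; [II] p. 18 uses `0 < g_k ≤ γ`) and the tower at the new index `k+1`
  (maps on localization domains and configurations; the [II]-family `F` REPRESENTING the tower's new term — [II] p. 21
  distinguishes *"the terms of the effective action E^{(k+1)} in (I.1.3)"* (`StepData.Ek1`, bound (I.1.18) with ½E₀) from the
  *"terms of the effective action in the representation (I.1.6)"* (`StepData.Etot = Ek1 + Elog`, bound with E₀), and the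
  cell's tower carries `log Z^{(j)}` separately (`Step.SFTower.logZ`, `action13`), so both readings are provided for; the
  reading of `Repr17` = "the representation (I.1.6)/(I.1.7) for j = k + 1 is achieved" (the informal reading of the field
  `B13.StepData.Repr17`, not a printed sentence; print, [II] p. 11: *"In the last section we have represented the fluctuation
  field action in the form (I.1.7) for j = k + 1, with the analyticity properties and bounds slightly better than demanded by
  the inductive assumption."*, p. 21: *"For this expression we construct the representation (I.1.7) using the generalized
  random walk expansion for Z^{(k)}(U_{k+1})."*) as B12 (1.7) p. 261 *"the term corresponding to a domain X depends on U_j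
  restricted to X"*, and of `GaugeInv` = invariance *"with
  respect to the simultaneous gauge transformations (I.3.29)"* ([II] Lemma 2 p. 11, pp. 21–22) as B12 (1.19) p. 263 for the
  tower's action `act` (1.10)), and the pure transport lemma `bound118_transport` (a bound of shape (I.1.18) moves along
  such maps when the constants compare).
* Part B — the clauses of `SFNewTerm T c k` SOURCED: `localDep`, `bound118`, `gaugeInv119` from [II]'s delivered clauses
  through the dictionary — in the representation (I.1.6) from `B13.Deliverables` (pp. 15, 21–22; `sfNewTerm_of_deliverables`),
  in the representation (I.1.3) from (2.41) + the two *"last assumptions"* of p. 21 via `B13.bound118_of_bound241` (½E₀;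
  `sfNewTerm_of_bound241`); `spaceInv` = B12 p. 263 *"The spaces U^c_j(X,α_0,α_1) are, by the definition, gauge invariant
  also."* (p. 262: the space *"is a union of orbits"* of (1.10); conditions (i)–(iv) are reader-owned, so this is a named
  hypothesis `SpacesGaugeInvariant` of exactly the shape of the clause); `rg` = the DEFINITION (2.15) p. 268 of `g_{k+1}` (`rg_of_satisfiesRG`);
  `betaBound` from §5 — (5.42) p. 297 *"This is the fundamental equality defining the β-function"* (= (1.22), typed
  `B12Beta.secondMoment`) and (5.10) p. 293 *"|Π_{μν}(x − y)| ≤ O(1)E₀ exp(−δ₁|x − y|)"* — via the gen-1 kernel lemma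
  `B12Sec2to5.secondMoment_abs_le_of_decay510` (`Beta542Source`, `betaBound_of_beta542`); and `betaSmooth` — p. 264 *"It is
  a smooth function defined on the interval [0,γ], (or analytic), uniformly bounded on this interval together with all
  derivatives. We will investigate other properties in a separate paper."* — ASSERTED in the inductive description and
  PROVED NOWHERE in §§2–5 nor in [II] (cell GAPS.md G-b12-2 (ii), G-adv2-3, G-adv2-6): it enters as the one NAMED,
  UNSOURCED hypothesis `BetaSmoothAt` of the assembly `sfNewTerm_of_bound` (and of its two reading-specific corollaries).
  That assembly is the per-step deliverable *"one `SFNewTerm T c k`"* of the cell's STEP.md §10 item 8.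
* Part C — the three typings agree: under a run dictionary `RunDict` (`D.flow = T.flow`, `D.IndAss k ↔ SFHyp T c k`),
  `B13.SmallFieldStep D K γ ↔ (∀ k < K, 0 < g_j ≤ γ (j ≤ k+1) → SFHyp T c k → SFNewTerm T c k)` (`smallFieldStep_iff_steps`,
  by `Step.SFHyp.succ_iff`), the §2 reduction sentence HOLDS as typed (`sec2Reduction_holds`: it is `Step.SFHyp.succ` — the
  old terms are unchanged as functions, B12 p. 256, DIVERGENCE D-f2.11), and `B12Sec2to5.NewTermDelivered` with
  `NewTerm (k+1) := SFNewTerm T c k` is the same per-step statement (`newTermDelivered_iff_steps`).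
* Part D — run level: the per-step statements give `Step.SFStepObligation` and `Step.B12Thm3Shape` by
  `(B12Thm3Shape_iff_obligation …).mpr` (no induction re-proved), and the whole chain [II]-deliverables-given-the-
  hypotheses-at-k + dictionary + (2.15) + p. 263 + §5 + the unsourced smoothness clause ⇒ `B12Thm3Shape`
  (`b12Thm3Shape_of_deliverables`).
TYPING NOTES.  (1) `Step.SFNewTerm.localDep` / `.gaugeInv119` quantify over EVERY real value `g` of the coupling argument
of `T.E (k+1) X g`, while print has `g_{j−1} ∈ [0, γ]` (B12 p. 263) and [II] works at `0 < g_k ≤ γ` (p. 18); accordingly the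
dictionary and the algebraic clauses `Repr17`/`GaugeInv` are taken at every `g` (outside `[0, γ]` they concern whatever
extension of the new term the instantiating reader chose), and the bound clauses only on `[0, γ]`; `g = 0` is included as in
`Step.SFHyp.bound118` (the exponent of (2.13) is `g_k`-proportional, cell GAPS.md G-b12-1) — cell DIVERGENCE.md D-b03.5.
(2) Analyticity of `E^{(k+1)}(X)` on `U^c_{k+1}(X, α₀, α₁)` ([II] p. 15, field `Deliverables.analytic`) and the clause
*"It is a C^∞-function of g_{j−1} ∈ [0,γ]"* (B12 p. 263) are not fields of `Step.SFHyp` (no complex structure on the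
abstract `Φ`, DIVERGENCE D-f2.1; GAPS G-b12-2 (i)) and are therefore not transported.  (3) Constants: [II] p. 21 DEFINES
`½E₀` as the absolute constant of the `log Z^{(k)}` terms and uses the `κ` of [I]; the comparison hypotheses `E₀[II] ≤ E₀`,
`κ ≤ κ[II]` (`ConstsCompare`) are the weak form of the intended equalities.  NOTHING of the series is asserted: every
`def …  : Prop` / `structure … : Prop` below is consumed only as a hypothesis; every `theorem` is kernel-checked bookkeeping or
elementary real analysis.  Unit `b2b-balaban-b03` gen 2 (phase-2 row P12b-E); records `HOME/GAPS.md` C-B12s-E1 (with the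
concurrence pointers G-b12-2 (ii) / G-adv2-3 / G-adv2-6 for the unsourced clause), `HOME/DIVERGENCE.md` D-b03.5–D-b03.6.
REVISION v2 (unit `b2b-balaban-pv20`, module cross-read `HOME/GAPS.md` G-pv20-2; DOCSTRINGS ONLY, no declaration or signature
changed): four quotation sites replaced by the printed sentences ([II] p. 1; [II] p. 11 / p. 21 for the reading of `Repr17`;
B12 p. 268 (2.15); B12 p. 293 (5.10), cell GAPS.md G-pv13-4 (1)) and print's *"for μ ≠ ν"* of (5.42) recorded at
`Beta542Source` (DIVERGENCE D-pv20.3).  The located form of the unsourced clause `BetaSmoothAt` (what it needs of `E`/`Π`,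
with the (1.22) derivative interchange kernel-checked) is the satellite module `B12BetaSmooth` (GAPS G-pv20-1 / C-pv20-1).
-/

namespace Literature.MathematicalPhysics.QuantumFieldTheory.Balaban1983to89.B12StepObligation

open Literature.MathematicalPhysics.QuantumFieldTheory.Balaban1983to89
open Literature.MathematicalPhysics.QuantumFieldTheory.Balaban1983to89.Step

variable {P : Params} {G : Type*} [GaugeGroup G] {Φ 𝒢 : Type*}

/-! ## Part A. Transport of the (I.1.18)-shape and the dictionary [II]-carrier ↔ tower index `k+1` -/

/-- Pure transport of a bound of the shape (I.1.18) (`B13.Bound118`: *"|E(X, φ)| ≤ E₀ exp(−κ d(X))"* on X-dependent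
spaces) along maps `ιX`, `ιφ` from one localized family to another: if the spaces map into the spaces, the terms agree on
them, the tree lengths do not decrease and the constants compare (`E₀' ≤ E₀`, `κ ≤ κ'`, `0 ≤ E₀'`, `0 ≤ κ`), the bound with
`(E₀', κ')` on the target gives the bound with `(E₀, κ)` on the source.  Elementary (monotonicity of `exp`). [folklore] -/
theorem bound118_transport {D D' : LocDomainSys} {Ψ Ψ' : Type*} (sp : D.Dom → Set Ψ) (sp' : D'.Dom → Set Ψ')
    (E : D.Dom → Ψ → ℂ) (E' : D'.Dom → Ψ' → ℂ) (ιX : D.Dom → D'.Dom) (ιφ : Ψ → Ψ') {E₀ E₀' κ κ' : ℝ}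
    (hE₀ : E₀' ≤ E₀) (hE₀' : 0 ≤ E₀') (hκ : κ ≤ κ') (hκ0 : 0 ≤ κ)
    (hdj : ∀ X, D.dj X ≤ D'.dj (ιX X)) (hsp : ∀ X φ, φ ∈ sp X → ιφ φ ∈ sp' (ιX X))
    (hEq : ∀ X φ, φ ∈ sp X → E X φ = E' (ιX X) (ιφ φ)) (h : B13.Bound118 D' sp' E' E₀' κ') :
    B13.Bound118 D sp E E₀ κ := by
  intro X φ hφ
  have hb := h (ιX X) (ιφ φ) (hsp X φ hφ)
  rw [hEq X φ hφ]
  have hd : 0 ≤ D.dj X := D.dj_nonneg X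
  have hd' : 0 ≤ D'.dj (ιX X) := D'.dj_nonneg (ιX X)
  have hrate : κ * D.dj X ≤ κ' * D'.dj (ιX X) :=
    le_trans (mul_le_mul_of_nonneg_left (hdj X) hκ0) (mul_le_mul_of_nonneg_right hκ hd')
  have hexp : Real.exp (-κ' * D'.dj (ιX X)) ≤ Real.exp (-κ * D.dj X) := by
    apply Real.exp_le_exp.mpr
    rw [neg_mul, neg_mul]
    exact neg_le_neg hrate
  calc ‖E' (ιX X) (ιφ φ)‖ ≤ E₀' * Real.exp (-κ' * D'.dj (ιX X)) := hb
    _ ≤ E₀' * Real.exp (-κ * D.dj X) := mul_le_mul_of_nonneg_left hexp hE₀'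
    _ ≤ E₀ * Real.exp (-κ * D.dj X) := mul_le_mul_of_nonneg_right hE₀ (Real.exp_pos _).le

/-- DICTIONARY between the one-step carrier of [II] and the small-field tower at the new index `k+1`.  `S g` = the data
of the step `k → k+1` of [II] §§1–2 performed at the value `g` of the coupling `g_k` ([II] p. 18: `0 < g_k ≤ γ`; the tower's
new term `E^{(k+1)}(X, g_k, 𝐔, 𝐉)` is a function of `g_k`, B12 p. 263, so one carrier per value); `ιX g` identifies the
tower's localization domains `D_{k+1}` (B12 p. 257) with [II]'s `𝐃_{k+1}` (field `Dk1`) without decreasing the tree length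
`d_{k+1}` (equality in the intended instance); `ιφ g` sends the tower's configuration pairs `(𝐔, 𝐉)` to [II]'s
configurations `(𝐔, 𝐉, B)`; `mem_sp2` = the tower's analyticity domain `U^c_{k+1}(X, α₀, α₁)` (B12 p. 262 (i)–(iv)) lies in
[II]'s *"space Uᶜ_{k+1}(X, α₀, α₁)"* of p. 15 (field `sp2`); `F g` = the [II]-family REPRESENTING the tower's new term
(`E_eq`): [II] p. 21 *"We gather all terms in the expansions, localized in X"* — `StepData.Etot = E^{(k+1)}(X) + Elog(X)` in
the representation (I.1.6), `StepData.Ek1 = E^{(k+1)}(X)` of (2.13) in the representation (I.1.3) (the cell's tower keeps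
`log Z^{(j)}` apart: `Step.SFTower.logZ`, `action13`; DIVERGENCE D-f2.3); `local_read` = the READING of [II]'s `Repr17`
(the field `B13.StepData.Repr17`, informally "the representation (I.1.6)/(I.1.7) for j = k + 1 is achieved"; print [II] p. 11
*"we have represented the fluctuation field action in the form (I.1.7) for j = k + 1"*, p. 21 *"For this expression we
construct the representation (I.1.7)"*) as B12 (1.7) p. 261 *"the term corresponding to a domain X depends on U_j restricted
to X"* for `F` and the tower's relation `agreeOn`; `gauge_read` = the READING of [II]'s `GaugeInv`
(Lemma 2 p. 11: *"gauge invariant with respect to the simultaneous gauge transformations (I.3.29)"*; pp. 21–22) as B12 (1.19)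
p. 263 *"E^{(j)}(X, g_{j−1}, 𝐔^u, R(u)𝐉) = E^{(j)}(X, g_{j−1}, 𝐔, 𝐉) for all G^c-valued gauge transformations u"* for the
tower's action `act` (1.10).  The fields are taken at every real `g` (TYPING NOTE (1) of the module docstring; cell
DIVERGENCE.md D-b03.5).  Data, not a claim: an instantiating reader supplies it. [cite: Balaban1988RG2Cluster, p.21 (closing paragraph) with pp.11, 15] -/
structure StepDict (T : SFTower P G Φ 𝒢) (c : SFConsts) (k : ℕ) (S : ℝ → B13.StepData) where
  ιX : (g : ℝ) → (T.sys (k+1)).Dom → (S g).Dk1.Dom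
  ιφ : (g : ℝ) → Φ → (S g).Φ
  dj_le : ∀ g X, (T.sys (k+1)).dj X ≤ (S g).Dk1.dj (ιX g X)
  mem_sp2 : ∀ g X φ, φ ∈ T.space (k+1) X c.α₀ c.α₁ → ιφ g φ ∈ (S g).sp2 (ιX g X)
  F : (g : ℝ) → (S g).Dk1.Dom → (S g).Φ → ℂ
  E_eq : ∀ g X φ, T.E (k+1) X g φ = F g (ιX g X) (ιφ g φ)
  local_read : ∀ g, (S g).Repr17 → ∀ X φ ψ, T.agreeOn (k+1) X φ ψ →
    F g (ιX g X) (ιφ g φ) = F g (ιX g X) (ιφ g ψ)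
  gauge_read : ∀ g X, (S g).GaugeInv (F g (ιX g X)) → ∀ u φ,
    F g (ιX g X) (ιφ g (T.act u φ)) = F g (ιX g X) (ιφ g φ)

/-- Comparison of the constants of [II] (`B13.Consts`: `E₀`, `κ`) with those of the inductive hypotheses of [I]
(`Step.SFConsts`): [II] p. 21 *"We define ½E₀ as equal to this constant"* (so `E₀[II]` = the `E₀` of (I.1.18)) and the decay
rate `κ` of (2.41)/(I.1.18) is the `κ` of [I]; typed as the weak comparisons the transport needs, with the signs
`0 ≤ E₀[II]`, `0 ≤ κ` (B12 Thm 3 p. 264 *"There exist positive constants κ₀, …"*, κ ≥ κ₀). [cite: Balaban1988RG2Cluster, p.21 (definition of ½E₀)] -/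
structure ConstsCompare (c13 : B13.Consts) (c : SFConsts) : Prop where
  E₀_le : c13.E₀ ≤ c.E₀
  E₀_nonneg : 0 ≤ c13.E₀
  κ_le : c.κ ≤ c13.κ
  κ_nonneg : 0 ≤ c.κ

/-! ## Part B. The clauses of `Step.SFNewTerm T c k`, sourced -/

section Clauses

/-- **(1.7) at `j = k+1` from [II].**  [II] p. 11 (Lemma 2) / p. 21: the representation (I.1.6)/(I.1.7) for A_{k+1} is
achieved (`Deliverables.repr`, i.e. `Repr17`), read through the dictionary as local dependence of the tower's new term
(B12 (1.7) p. 261).  Bookkeeping. [cite: Balaban1988RG2Cluster, p.21 (representation (I.1.6)/(I.1.7) for A_{k+1})] -/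
theorem localDep_of_dict {T : SFTower P G Φ 𝒢} {c : SFConsts} {k : ℕ} {S : ℝ → B13.StepData}
    (Δ : StepDict T c k S) (hrepr : ∀ g, (S g).Repr17) :
    ∀ X g φ ψ, T.agreeOn (k+1) X φ ψ → T.E (k+1) X g φ = T.E (k+1) X g ψ := by
  intro X g φ ψ h
  rw [Δ.E_eq g X φ, Δ.E_eq g X ψ]
  exact Δ.local_read g (hrepr g) X φ ψ h

/-- **(1.18) at `j = k+1` from [II].**  [II] p. 21: *"This yields the bounds (I.1.18) for terms of the effective action in
the representation (I.1.6) also."* (`Deliverables.bound : Bound118 S.Dk1 S.sp2 S.Etot E₀ κ`, itself assembled in `B13` from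
Lemma 3 → (2.41) → ½E₀ + the log Z^{(k)} half) and, for the (I.1.3)-terms alone, *"the inequality (I.1.18), with ½E₀
instead of E₀"* (`B13.bound118_of_bound241`): a bound of shape (I.1.18) for the representing family `F` with constants
`(E₀', κ')`, `E₀' ≤ E₀`, `κ ≤ κ'`, at every value `g ∈ [0, γ]` of the coupling, is transported to the tower's clause
`bound118` at the index `k+1` by `bound118_transport`. [cite: Balaban1988RG2Cluster, p.21 ("This yields the bounds (I.1.18)")] -/
theorem bound118_of_dict {T : SFTower P G Φ 𝒢} {c : SFConsts} {k : ℕ} {S : ℝ → B13.StepData}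
    (Δ : StepDict T c k S) {E₀' κ' : ℝ} (hE₀ : E₀' ≤ c.E₀) (hE₀' : 0 ≤ E₀') (hκ : c.κ ≤ κ') (hκ0 : 0 ≤ c.κ)
    (hbound : ∀ g, 0 ≤ g → g ≤ c.γ → B13.Bound118 (S g).Dk1 (S g).sp2 (Δ.F g) E₀' κ') :
    ∀ X g φ, 0 ≤ g → g ≤ c.γ → φ ∈ T.space (k+1) X c.α₀ c.α₁ →
      ‖T.E (k+1) X g φ‖ ≤ c.E₀ * Real.exp (-c.κ * (T.sys (k+1)).dj X) := by
  intro X g φ hg0 hgγ hφ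
  have h := bound118_transport (fun X => T.space (k+1) X c.α₀ c.α₁) (S g).sp2 (fun X φ => T.E (k+1) X g φ)
    (Δ.F g) (Δ.ιX g) (Δ.ιφ g) hE₀ hE₀' hκ hκ0 (Δ.dj_le g) (Δ.mem_sp2 g)
    (fun X φ _ => Δ.E_eq g X φ) (hbound g hg0 hgγ)
  exact h X φ hφ

/-- **(1.19) at `j = k+1` from [II].**  [II] pp. 21–22: gauge invariance of the terms of A_{k+1} *"by Lemma 2, and the
transformation properties of the operators in (2.14) … We extend them to constant functions on whole orbits"*
(`Deliverables.gauge`), read through the dictionary as B12 (1.19) for the tower's action (1.10).  Bookkeeping. [cite: Balaban1988RG2Cluster, pp.21–22 (gauge invariance (I.1.19))] -/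
theorem gaugeInv119_of_dict {T : SFTower P G Φ 𝒢} {c : SFConsts} {k : ℕ} {S : ℝ → B13.StepData}
    (Δ : StepDict T c k S) (hgauge : ∀ g X, (S g).GaugeInv (Δ.F g X)) :
    ∀ X g u φ, T.E (k+1) X g (T.act u φ) = T.E (k+1) X g φ := by
  intro X g u φ
  rw [Δ.E_eq g X (T.act u φ), Δ.E_eq g X φ]
  exact Δ.gauge_read g X (hgauge g (Δ.ιX g X)) u φ

/-- **Gauge invariance of the spaces at `j = k+1`.**  B12 p. 263 [PDF 15], verbatim: *"The spaces U^c_j(X,α_0,α_1) are, by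
the definition, gauge invariant also."* — the definition being p. 262 [PDF 14] *"The space U^c_j(X, α_0, α_1, γ_0) is a union
of orbits [(𝐔,𝐉)] determined by configurations 𝐔, 𝐉 satisfying the four conditions written below"* ((i)–(iv), reader-owned in
the cell's typing: `Step.SFTower.space` is an abstract family of sets), hence a named hypothesis here — "union of orbits of the
action (1.10)" for one index `j`, which is literally the shape of `Step.SFHyp.spaceInv`. [cite: Balaban1987RG1, p.262–263 (definition of U^c_j; after (1.19))] -/
def SpacesGaugeInvariant (T : SFTower P G Φ 𝒢) (c : SFConsts) (j : ℕ) : Prop :=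
  ∀ X u φ, φ ∈ T.space j X c.α₀ c.α₁ → T.act u φ ∈ T.space j X c.α₀ c.α₁

/-- **(2.15) = the definition of `g_{k+1}`.**  B12 p. 268 [PDF 20], verbatim: *"Finally we perform the coupling constant
renormalization (2.15) 1/g_k² = 1/g_{k+1}² + β_{k+1}(g_k) with the β-function defined by the formulas (1.20), (1.22) for
j = k. The equalities (2.12), (2.14) together with the definitions (2.13), (2.15) imply that the action A_{k+1} is given by
(1.3) with k+1 instead of k."* (print calls (2.15) a definition; likewise p. 256 [PDF 8] *"the coupling constant g_{k+1} is
determined from the equation (0.20)"*) — the clause `rg` of the obligation is one instance of `Setup.Flow.SatisfiesRG` (= the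
run's definition of its coupling sequence, `Step.GeneratedBySmallFieldRT.rg`). [cite: Balaban1987RG1, (2.15) p.268] -/
theorem rg_of_satisfiesRG {T : SFTower P G Φ 𝒢} {k K : ℕ} (h : T.flow.SatisfiesRG K) (hk : k < K) :
    1 / (T.flow.g k) ^ 2 = 1 / (T.flow.g (k+1)) ^ 2 + T.flow.β (k+1) (T.flow.g k) :=
  h k hk

/-- THE §5 SOURCE OF THE CLAUSE `betaBound` AT THE NEW INDEX.  B12 (1.22) p. 264 / (5.42) p. 297, verbatim: *"β =
−(∂²/∂p₁∂p₂ Π̃₁₂)(0) = … = Σ_x Π_{μν}(x) x_μ x_ν for μ ≠ ν. This is the fundamental equality defining the β-function."*,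
p. 298 *"Defining the function β_j as equal to the coefficient β in (5.43) … we should write the superscript (j) at the
tensor in the formula (5.42)"* (`beta_eq`: `β_{k+1}(g)` is the second moment `B12Beta.secondMoment` of the component kernel
`Π^{(k+1)}_{μν}(g, ·)`, one kernel `Pk g` per value of the coupling; print has *"for μ ≠ ν"* and d = 4 — the pair `μ ν` and
`d` are left to the instantiating reader, who takes `μ ≠ ν`: cell DIVERGENCE.md D-pv20.3); (5.10) p. 293 [PDF 45] *"The
representation (4.37) yields the following inequality |Π_{μν}(x − y)| ≤ O(1)E₀ exp(−δ₁|x − y|), (5.10) with a positive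
constant δ₁ determined by δ₀, κ, and M (e.g., δ₁ = ½ min{δ₀, κM⁻¹})."* (`decay`, for `g ∈ [0, γ]`; the constant `C` = O(1)E₀;
(5.10) is itself asserted from the representation (4.37), no proof printed: cell GAPS.md G-B12s-15, G-pv13-4 (1)); and the
identification of the cell's
uniform bound `β′` (`Step.SFConsts.β'`, p. 264 *"uniformly bounded on this interval"*) with a number at least the explicit
`B12Sec2to5.betaPrime510 d C δ₁ = C · Σ_x |x|₁² e^{−δ₁|x|₁}` (`le_beta'`).  Data + hypotheses, not a claim. [cite: Balaban1987RG1, (5.42) p.297 with (5.10) p.293] -/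
structure Beta542Source (T : SFTower P G Φ 𝒢) (c : SFConsts) (k : ℕ) where
  d : ℕ
  μ : Fin d
  ν : Fin d
  Pk : ℝ → B12Beta.Kernel d
  C : ℝ
  δ₁ : ℝ
  δ₁_pos : 0 < δ₁
  beta_eq : ∀ g, 0 ≤ g → g ≤ c.γ → T.flow.β (k+1) g = B12Beta.secondMoment (Pk g) μ ν
  decay : ∀ g, 0 ≤ g → g ≤ c.γ → B12Sec2to5.Decay510 (Pk g μ ν) C δ₁
  le_beta' : B12Sec2to5.betaPrime510 d C δ₁ ≤ c.β'

/-- **`betaBound` at `j = k+1` from §5**: (5.42) + (5.10) ⇒ `|β_{k+1}(g)| ≤ β′` for `g ∈ [0, γ]`, by the gen-1 kernel lemma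
`B12Sec2to5.secondMoment_abs_le_of_decay510` (dominated summation of the lattice sum (1.22)).  This is what §5 proves about
`β_{k+1}` — a uniform absolute bound; no sign, no lower bound, no derivative bound (cell GAPS.md G-adv2-3). [cite: Balaban1987RG1, (5.10) p.293 and (5.42) p.297] -/
theorem betaBound_of_beta542 {T : SFTower P G Φ 𝒢} {c : SFConsts} {k : ℕ} (B : Beta542Source T c k) :
    ∀ x ∈ Set.Icc (0:ℝ) c.γ, |T.flow.β (k+1) x| ≤ c.β' := by
  intro x hx
  rw [B.beta_eq x hx.1 hx.2]
  exact le_trans (B12Sec2to5.secondMoment_abs_le_of_decay510 B.δ₁_pos (B.decay x hx.1 hx.2)).2 B.le_beta'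

/-- **THE UNSOURCED CLAUSE.**  B12 p. 264 [PDF 16], verbatim, of `β_{j+1}`: *"It is a smooth function defined on the interval
[0,γ], (or analytic), uniformly bounded on this interval together with all derivatives. We will investigate other properties
in a separate paper. This completes the description of the inductive assumptions."* — the smoothness half, in the shape of
`Step.SFNewTerm.betaSmooth`.  It is ASSERTED as part of the inductive description and is proved NEITHER in §§2–5 of [I] (the
reduction sentence p. 269 narrows the target to (1.7) + analyticity + (1.18); §5 proves (5.42) and bounds, no g-regularity)
NOR in [II] (whose closing pp. 19–22 does not mention it): cell GAPS.md G-b12-2 (ii), G-adv2-3, G-adv2-6.  In this module it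
is the ONE hypothesis of the step obligation with no printed source; it is exactly what the flow step (B12 Thm 2: continuity
for the shooting argument, `Step.flow_exists_of_betaBounds`) consumes. [cite: Balaban1987RG1, p.264 (β-clause after (1.22))] -/
def BetaSmoothAt (T : SFTower P G Φ 𝒢) (c : SFConsts) (k : ℕ) : Prop :=
  ∀ n : ℕ, ContDiffOn ℝ n (T.flow.β (k+1)) (Set.Icc 0 c.γ)

/-- **THE PER-STEP DELIVERABLE** (cell STEP.md §10 item 8: *"your per-step deliverable is one `SFNewTerm T c k`"*), assembled
from its printed sources, generic in the reading: [II]'s bound of shape (I.1.18) for the family representing the new term at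
every coupling value `g ∈ [0, γ]` with comparable constants (`hbound`), [II]'s algebraic clauses `Repr17` / `GaugeInv` for that
family at every `g` (`hrepr`, `hgauge`; TYPING NOTE (1)), the dictionary, (2.15), the gauge invariance of the spaces (B12
p. 263), the §5 source of the β-bound, and the UNSOURCED smoothness clause `BetaSmoothAt`.  Kernel-checked bookkeeping;
nothing of the series is asserted. [cite: Balaban1988RG2Cluster, p.22 ("completes the proof of the inductive assumptions for the action A_{k+1}")] -/
theorem sfNewTerm_of_bound {T : SFTower P G Φ 𝒢} {c : SFConsts} {k : ℕ} {S : ℝ → B13.StepData}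
    (Δ : StepDict T c k S) {E₀' κ' : ℝ} (hE₀ : E₀' ≤ c.E₀) (hE₀' : 0 ≤ E₀') (hκ : c.κ ≤ κ') (hκ0 : 0 ≤ c.κ)
    (hbound : ∀ g, 0 ≤ g → g ≤ c.γ → B13.Bound118 (S g).Dk1 (S g).sp2 (Δ.F g) E₀' κ')
    (hrepr : ∀ g, (S g).Repr17) (hgauge : ∀ g X, (S g).GaugeInv (Δ.F g X))
    (hrg : 1 / (T.flow.g k) ^ 2 = 1 / (T.flow.g (k+1)) ^ 2 + T.flow.β (k+1) (T.flow.g k))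
    (hsp : SpacesGaugeInvariant T c (k+1)) (hβ : Beta542Source T c k) (hsmooth : BetaSmoothAt T c k) :
    SFNewTerm T c k where
  rg := hrg
  localDep := localDep_of_dict Δ hrepr
  bound118 := bound118_of_dict Δ hE₀ hE₀' hκ hκ0 hbound
  spaceInv := hsp
  gaugeInv119 := gaugeInv119_of_dict Δ hgauge
  betaSmooth := hsmooth
  betaBound := betaBound_of_beta542 hβ

/-- **Reading (I.1.6)** — the new term is the X-localized term of A_{k+1} with the log Z^{(k)} contribution included
(`Δ.F g = StepData.Etot`): [II]'s delivered clauses `B13.Deliverables (S g) c13` (representation (I.1.7), analyticity,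
(I.1.18) with `E₀`, (I.1.19); pp. 15, 21–22) at every `g ∈ [0, γ]` + the constant comparison give the per-step deliverable.
[cite: Balaban1988RG2Cluster, p.21 ("This yields the bounds (I.1.18) … in the representation (I.1.6) also")] -/
theorem sfNewTerm_of_deliverables {T : SFTower P G Φ 𝒢} {c : SFConsts} {k : ℕ} {S : ℝ → B13.StepData}
    {c13 : B13.Consts} (Δ : StepDict T c k S) (hF : ∀ g, Δ.F g = (S g).Etot) (hc : ConstsCompare c13 c)
    (hdel : ∀ g, 0 ≤ g → g ≤ c.γ → B13.Deliverables (S g) c13)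
    (hrepr : ∀ g, (S g).Repr17) (hgauge : ∀ g X, (S g).GaugeInv ((S g).Etot X))
    (hrg : 1 / (T.flow.g k) ^ 2 = 1 / (T.flow.g (k+1)) ^ 2 + T.flow.β (k+1) (T.flow.g k))
    (hsp : SpacesGaugeInvariant T c (k+1)) (hβ : Beta542Source T c k) (hsmooth : BetaSmoothAt T c k) :
    SFNewTerm T c k :=
  sfNewTerm_of_bound Δ hc.E₀_le hc.E₀_nonneg hc.κ_le hc.κ_nonneg
    (fun g hg0 hgγ => by rw [hF g]; exact (hdel g hg0 hgγ).bound) hrepr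
    (fun g X => by rw [hF g]; exact hgauge g X) hrg hsp hβ hsmooth

/-- **Reading (I.1.3)** — the new term is `E^{(k+1)}(X)` of (2.13) alone (`Δ.F g = StepData.Ek1`; the cell's tower, whose
`action13` carries `log Z^{(j)}` separately): [II] p. 21 *"The inequality (2.41) and the assumptions imply the inequality
(I.1.18), with ½E₀ instead of E₀, for the terms of the effective action E^{(k+1)} in (I.1.3)."* — (2.41) at every `g ∈ [0, γ]`
+ the two *"last assumptions"* `(1 − 10δ)½L = 1`, `O(1)C₃ε₁ ≤ ½E₀` (`B13.Consts.R22/R23`) through `B13.bound118_of_bound241`,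
and `½E₀[II] ≤ E₀`. [cite: Balaban1988RG2Cluster, p.21 (after (2.41))] -/
theorem sfNewTerm_of_bound241 {T : SFTower P G Φ 𝒢} {c : SFConsts} {k : ℕ} {S : ℝ → B13.StepData}
    {c13 : B13.Consts} (Δ : StepDict T c k S) (hF : ∀ g, Δ.F g = (S g).Ek1) (hc : ConstsCompare c13 c)
    (h241 : ∀ g, 0 ≤ g → g ≤ c.γ → B13.Bound241 (S g) c13) (h22 : c13.R22) (h23 : c13.R23)
    (hrepr : ∀ g, (S g).Repr17) (hgauge : ∀ g X, (S g).GaugeInv ((S g).Ek1 X))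
    (hrg : 1 / (T.flow.g k) ^ 2 = 1 / (T.flow.g (k+1)) ^ 2 + T.flow.β (k+1) (T.flow.g k))
    (hsp : SpacesGaugeInvariant T c (k+1)) (hβ : Beta542Source T c k) (hsmooth : BetaSmoothAt T c k) :
    SFNewTerm T c k :=
  have hE : c13.E₀ / 2 ≤ c.E₀ := by linarith [hc.E₀_le, hc.E₀_nonneg]
  have hE' : 0 ≤ c13.E₀ / 2 := by linarith [hc.E₀_nonneg]
  sfNewTerm_of_bound Δ hE hE' hc.κ_le hc.κ_nonneg
    (fun g hg0 hgγ => by rw [hF g]; exact B13.bound118_of_bound241 (S g) c13 (h241 g hg0 hgγ) h22 h23) hrepr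
    (fun g X => by rw [hF g]; exact hgauge g X) hrg hsp hβ hsmooth

/-- Conversely (bookkeeping): the obligation CONTAINS the two β-clauses and (2.15) verbatim — so `BetaSmoothAt` is not an
artefact of this module's assembly but a conjunct of what Theorem 3's step asserts (`Step.SFHyp.betaSmooth` at `j = k+1`). [folklore] -/
theorem betaSmoothAt_of_sfNewTerm {T : SFTower P G Φ 𝒢} {c : SFConsts} {k : ℕ} (h : SFNewTerm T c k) :
    BetaSmoothAt T c k := h.betaSmooth

end Clauses

/-! ## Part C. The three typings of the step agree -/

section Agree
variable {T : SFTower P G Φ 𝒢} {c : SFConsts}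

/-- DICTIONARY between the run carrier of `B12` (reader r2: `RunData`, with the abstract predicate `IndAss k` = *"A_k
satisfies all the inductive assumptions described between (1.1)–(1.22)"*, B12 Thm 3 p. 264) and the clause-level typing
(`Step.SFHyp T c k` over a tower): the same coupling flow, and `IndAss k` read as `SFHyp T c k`.  The identification is the
reader's (the clauses (1.1)–(1.6), (1.11)–(1.17) on backgrounds/spaces, Euclidean covariance, analyticity and g-smoothness of
the terms are not fields of `SFHyp`: `Step` docstrings, DIVERGENCE D-f2.1, GAPS G-b12-2 (i)); typed as a hypothesis. [cite: Balaban1987RG1, Thm 3 p.264 ("satisfy the above inductive hypotheses")] -/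
structure RunDict (D : B12.RunData) (T : SFTower P G Φ 𝒢) (c : SFConsts) : Prop where
  flow_eq : D.flow = T.flow
  indAss_iff : ∀ k, D.IndAss k ↔ SFHyp T c k

/-- `B13.SmallFieldStep` (the node [II] p. 22 delivers, reader r2/b13) IS the per-step obligation statement of `Step` Part E
under the run dictionary: `SmallFieldStep D K γ ↔ ∀ k < K, (0 < g_j ≤ γ, j ≤ k+1) → SFHyp T c k → SFNewTerm T c k` — by
`Step.SFHyp.succ_iff` (`SFHyp T c (k+1) ↔ SFHyp T c k ∧ SFNewTerm T c k`).  Kernel-checked bookkeeping. [folklore] -/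
theorem smallFieldStep_iff_steps {D : B12.RunData} (hD : RunDict D T c) (K : ℕ) :
    B13.SmallFieldStep D K c.γ ↔
      ∀ k, k < K → T.flow.InInterval c.γ (k+1) → SFHyp T c k → SFNewTerm T c k := by
  unfold B13.SmallFieldStep
  rw [hD.flow_eq]
  constructor
  · intro h k hk hI hH
    exact ((hD.indAss_iff (k+1)).mp (h k hk hI ((hD.indAss_iff k).mpr hH))).newTerm
  · intro h k hk hI hA
    exact (hD.indAss_iff (k+1)).mpr (((hD.indAss_iff k).mp hA).succ (h k hk hI ((hD.indAss_iff k).mp hA)))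

/-- The §2 reduction sentence of [I] (p. 268–269, typed `B12Sec2to5.Sec2Reduction` with the abstract new-term predicate) HOLDS
when the new-term predicate at `k+1` is read as `Step.SFNewTerm T c k`: it is `Step.SFHyp.succ` — *"in the old [expression]
only a background field is changed"* (B12 p. 256; the old terms are unchanged as functions, DIVERGENCE D-f2.11).  So of the
two factors of `B12Sec2to5.smallFieldStep_of_sec2` only `NewTermDelivered` carries content. [cite: Balaban1987RG1, §2 pp.268–269 (reduction to (2.13))] -/
theorem sec2Reduction_holds {D : B12.RunData} (hD : RunDict D T c) (K : ℕ) :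
    B12Sec2to5.Sec2Reduction D (fun j => SFNewTerm T c (j - 1)) K c.γ := by
  intro k _ _ hA hN
  have hN' : SFNewTerm T c k := by simpa using hN
  exact (hD.indAss_iff (k+1)).mpr (((hD.indAss_iff k).mp hA).succ hN')

/-- … and `B12Sec2to5.NewTermDelivered` (p. 269 *"the rest of the paper is almost completely devoted to these problems"*;
[II] p. 22) with `NewTerm (k+1) := SFNewTerm T c k` is literally the per-step obligation statement.  Bookkeeping. [folklore] -/
theorem newTermDelivered_iff_steps {D : B12.RunData} (hD : RunDict D T c) (K : ℕ) :
    B12Sec2to5.NewTermDelivered D (fun j => SFNewTerm T c (j - 1)) K c.γ ↔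
      ∀ k, k < K → T.flow.InInterval c.γ (k+1) → SFHyp T c k → SFNewTerm T c k := by
  unfold B12Sec2to5.NewTermDelivered
  rw [hD.flow_eq]
  constructor
  · intro h k hk hI hH
    simpa using h k hk hI ((hD.indAss_iff k).mpr hH)
  · intro h k hk hI hA
    simpa using h k hk hI ((hD.indAss_iff k).mp hA)

end Agree

/-! ## Part D. Run level: `Step.SFStepObligation` and `Step.B12Thm3Shape` from the per-step statements -/

section Run
variable [MeasurableSpace G] [HaarData G]
variable (av : ∀ j, Averaging P j G) (Tk : ∀ k, RTOp P k G (av k)) (χ GF : ∀ k, Density P k G)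
  (bg : Background P G av) (A : ∀ k, Density P k G) (T : SFTower P G Φ 𝒢) (c : SFConsts) (K : ℕ)

/-- The per-step statements (with the interval hypothesis up to `k+1`, as in `B13.SmallFieldStep`) give the per-step
OBLIGATION FORM of B12 Theorem 3 (`Step.SFStepObligation`, whose interval hypothesis is the global `0 < g_k ≤ γ, k ≤ K` of
Thm 3 p. 264).  Bookkeeping (restriction of the interval hypothesis). [folklore] -/
theorem sfStepObligation_of_steps
    (hstep : ∀ k, k < K → T.flow.InInterval c.γ (k+1) → SFHyp T c k → SFNewTerm T c k) :
    SFStepObligation av Tk χ GF bg A T c K :=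
  fun _ hI k hk hH => hstep k hk (fun j hj => hI j (le_trans hj (Nat.succ_le_of_lt hk))) hH

/-- … hence the SHAPE of B12 Theorem 3, by `(B12Thm3Shape_iff_obligation …).mpr` — the induction on `k` is f2's
`Step.sfHyp_all_of_steps`, not re-proved (cell STEP.md §10 item 8). [folklore] -/
theorem b12Thm3Shape_of_steps
    (hstep : ∀ k, k < K → T.flow.InInterval c.γ (k+1) → SFHyp T c k → SFNewTerm T c k) :
    B12Thm3Shape av Tk χ GF bg A T c K :=
  (B12Thm3Shape_iff_obligation av Tk χ GF bg A T c K).mpr (sfStepObligation_of_steps av Tk χ GF bg A T c K hstep)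

/-- … and from the node of [II] over a run carrier bound to the tower (`RunDict`): `B13.SmallFieldStep D K γ ⇒ B12Thm3Shape`. [folklore] -/
theorem b12Thm3Shape_of_smallFieldStep {D : B12.RunData} (hD : RunDict D T c) (h : B13.SmallFieldStep D K c.γ) :
    B12Thm3Shape av Tk χ GF bg A T c K :=
  b12Thm3Shape_of_steps av Tk χ GF bg A T c K ((smallFieldStep_iff_steps hD K).mp h)

/-- **THE WHOLE CHAIN, typed.**  For the sequence generated by the small-field transformations (whose definition includes
(2.15), `GeneratedBySmallFieldRT.rg`) with the couplings in the interval: IF at every step `k < K`, GIVEN the inductive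
hypotheses at `k` (under which [II] works: p. 1 [PDF 1] *"In the first paper of this series we have considered the fluctuation
field integral defined by the k-th renormalization transformation. … We prove also that terms of this expansion satisfy the
inductive assumptions formulated in the first paper. Thus we complete the proof of Theorem 3 of that paper."*), [II] delivers
its clauses for the step performed at every coupling value `g ∈ [0, γ]` (`hdel`) together with
the algebraic clauses at every `g` (`hrepr`, `hgauge`), the carriers are bound to the tower in the representation (I.1.6)
(`Δ`, `hF`; the (I.1.3) reading is `sfNewTerm_of_bound241` per step), the constants compare
(`hc`), the spaces are gauge invariant by definition (B12 p. 263, `hsp`), `β_{k+1}` is the second moment (5.42) of a kernel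
obeying (5.10) with `β′ ≥ betaPrime510` (`hβ`), AND the unsourced smoothness clause of p. 264 holds (`hsmooth`) — THEN the
shape of B12 Theorem 3 is inhabited for this run.  Every input is a hypothesis named by its printed source (or, for
`hsmooth`, by its absence); kernel-checked composition. [cite: Balaban1988RG2Cluster, p.1 and p.22 (completion of the proof of Thm I.3)] -/
theorem b12Thm3Shape_of_deliverables (S : ℕ → ℝ → B13.StepData) (c13 : B13.Consts)
    (Δ : ∀ k, StepDict T c k (S k)) (hF : ∀ k g, (Δ k).F g = (S k g).Etot) (hc : ConstsCompare c13 c)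
    (hdel : ∀ k, k < K → SFHyp T c k → T.flow.InInterval c.γ (k+1) →
      ∀ g, 0 ≤ g → g ≤ c.γ → B13.Deliverables (S k g) c13)
    (hrepr : ∀ k g, (S k g).Repr17) (hgauge : ∀ k g X, (S k g).GaugeInv ((S k g).Etot X))
    (hsp : ∀ k, k < K → SpacesGaugeInvariant T c (k+1))
    (hβ : ∀ k, k < K → Beta542Source T c k) (hsmooth : ∀ k, k < K → BetaSmoothAt T c k) :
    B12Thm3Shape av Tk χ GF bg A T c K := by
  refine (B12Thm3Shape_iff_obligation av Tk χ GF bg A T c K).mpr ?_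
  intro hgen hI k hk hH
  have hIk : T.flow.InInterval c.γ (k+1) := fun j hj => hI j (le_trans hj (Nat.succ_le_of_lt hk))
  exact sfNewTerm_of_deliverables (Δ k) (hF k) hc (hdel k hk hH hIk) (hrepr k) (hgauge k)
    (rg_of_satisfiesRG hgen.rg hk) (hsp k hk) (hβ k hk) (hsmooth k hk)

end Run

end Literature.MathematicalPhysics.QuantumFieldTheory.Balaban1983to89.B12StepObligation
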